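import Summits.Ventures.HSemireg.WedgeWeilDegSel

/-!
# Venture HSemireg — THEOREM R-B in the wedge model (8/9)

HONEST FRAMING. Part of the Lean index of the computation cell `pub-hsemireg` (seat p3; Sunday enclosure of the
FORMULA-N kernel assets of seats th-7 / th-6, ENCLOSURE-PLAN-p3.md).  Finite-dimensional exterior algebra over a field ONLY:
no variety, no cohomology theory, no semiregularity map is constructed here; nothing here says that HC / HC_CM / HC_AV holds;
no Literature fact is declared or used.  The geometric DICTIONARY (why these ranks are the `HT`-side box ranks of the cell's
STRUCTURE.md §1 / theory/FORMULA-N.md) lives in theory/FORMULA-N-th7.md PART B §A.3 / §N and is NOT asserted in Lean.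

THEOREM R-B (FORMULA-N PART B §L.3 / §L.8; STRUCTURE D9, (F1) Weil-frame clause, C16) in the SIGN-FREE transposed wedge model — theory/th7/WeilRank.lean v3 sha256/16 7e5d6bad1a94e25a (th-7 g4, 18:46Z; ×2 farm th-2 g20 18:48:20Z); PART R/R2/R3 = l.1506–3436 on top of HankelRank v1 (= the tree's Wedge/WedgeHankel* files), VERBATIM up
to namespaces (`HSemiregWeil` ↦ `Summit.Ventures.HSemireg.Wedge.Weil`, which sees the wedge-model infrastructure `….Wedge` and opens `….Wedge.Hankel`), file 8 of 9.
MODEL: `N` pairs of generators `x_c`, `y_c`; the h-part `f = w_N(q)` (HankelRank); the «Weil vectors» `w₊ = E_{G₋}`, `w₋ = E_{G₊}` = the full monomials on the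
generator blocks of the last `N − p` / first `p` pairs (signature `(p, N − p)`; THEOREM R is `N = 2n`, `p = n`).  HEADLINES (files 5, 8, 9): `weilRank` /
`weilRank_nn` («rank(⌟v ∣ HT²) = (4 + ρ)·n² − 2n», `v = f + a w₊ + b w₋`, `ab ≠ 0`, `n ≥ 3`, ρ = rank H₂(q)), `ker_eq` (kernel = mixed 2-forms killing `f`),
`weilRank_deg` / `weilRank_nn_deg` (every degree `m`, `m + 1 ≤ N − p`), `weilRank_one` / `weilRank_nn_one` (one-sided, ε = 1).  No permutation sign is evaluated
(the pair symmetries act through `AlternatingMap.map_perm`; `sgn κ` is a unit).  This file (PART R2, 3/3): the counts `card_MXm`, `finrank_Mm`, `finrank_map_f_Mm`, **`weilRank_deg`** / **`weilRank_nn_deg`** (THEOREM R in every degree `m`, `1 ≤ m`, `m + 1 ≤ N − p`).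
-/

open Module Set Set.powersetCard Summit.Ventures.HSemireg.Wedge.Hankel

namespace Summit.Ventures.HSemireg.Wedge.Weil

variable (K : Type*) [Field K]

section AllDegrees

variable {N : ℕ}

variable (N)

/-- mixed `m`-sets of pairs (meeting the first `p` pairs and the rest). -/
def MXm (m p : ℕ) : Finset (Finset (Fin N)) :=
  ((Finset.univ : Finset (Fin N)).powersetCard m).filter fun S => ¬ S ⊆ Ap N p ∧ ¬ S ⊆ (Ap N p)ᶜ

variable {N}

omit [Field K] in
/-- `Apᶜ = Am`. -/
lemma compl_Ap (p : ℕ) : (Ap N p)ᶜ = Am N p := by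
  ext c; simp [Ap, Am]

/-- generic count: `m`-subsets meeting both `A` and `Aᶜ` (`m ≥ 1`). -/
lemma card_powersetCard_split {α : Type*} [DecidableEq α] [Fintype α] (A : Finset α) {m : ℕ} (hm : 1 ≤ m) :
    ((Finset.univ.powersetCard m).filter fun S : Finset α => ¬ S ⊆ A ∧ ¬ S ⊆ Aᶜ).card +
      A.card.choose m + Aᶜ.card.choose m = (Fintype.card α).choose m := by
  set U := (Finset.univ : Finset α).powersetCard m with hU
  have h1 := Finset.card_filter_add_card_filter_not (s := U) (fun S => S ⊆ A)
  have h2 := Finset.card_filter_add_card_filter_not (s := U.filter fun S => ¬ S ⊆ A) (fun S => S ⊆ Aᶜ)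
  have e1 : U.filter (fun S => S ⊆ A) = A.powersetCard m := by
    ext S
    simp only [hU, Finset.mem_filter, Finset.mem_powersetCard, Finset.subset_univ, true_and]
    tauto
  have e2 : (U.filter fun S => ¬ S ⊆ A).filter (fun S => S ⊆ Aᶜ) = Aᶜ.powersetCard m := by
    ext S
    simp only [hU, Finset.mem_filter, Finset.mem_powersetCard, Finset.subset_univ, true_and]
    constructor
    · rintro ⟨⟨h, -⟩, h'⟩; exact ⟨h', h⟩
    · rintro ⟨h', h⟩
      refine ⟨⟨h, fun hA => ?_⟩, h'⟩
      obtain ⟨x, hx⟩ : S.Nonempty := by rw [← Finset.card_pos, h]; exact hm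
      exact (Finset.mem_compl.mp (h' hx)) (hA hx)
  have e3 : (U.filter fun S => ¬ S ⊆ A).filter (fun S => ¬ S ⊆ Aᶜ) =
      U.filter (fun S => ¬ S ⊆ A ∧ ¬ S ⊆ Aᶜ) := Finset.filter_filter _ _ _
  have hUc : U.card = (Fintype.card α).choose m := by
    rw [hU, Finset.card_powersetCard, Finset.card_univ]
  rw [e1, Finset.card_powersetCard, hUc] at h1
  rw [e2, e3, Finset.card_powersetCard] at h2
  omega

/-- COUNT: `|MXm| + C(p,m) + C(N−p,m) = C(N,m)`. -/
lemma card_MXm {m p : ℕ} (hm : 1 ≤ m) (hp : p ≤ N) :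
    (MXm N m p).card + p.choose m + (N - p).choose m = N.choose m := by
  classical
  have h := card_powersetCard_split (Ap N p) (m := m) hm
  rw [Finset.card_compl, card_Ap hp, Fintype.card_fin] at h
  exact h

/-- `dim Mm + C(2p,m) + C(2N−2p,m) = C(2N,m)`. -/
lemma finrank_Mm {m p : ℕ} (hm : 1 ≤ m) (hp : p ≤ N) :
    Module.finrank K ↥(Mm K N m p) + (p + p).choose m + ((N + N) - (p + p)).choose m = (N + N).choose m := by
  classical
  have h := card_powersetCard_split (Dm N p) (m := m) hm
  rw [show (Dm N p)ᶜ = Gm N p from rfl, card_Dm hp, card_Gm hp, Fintype.card_fin] at h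
  have hf : (Finset.univ.filter (Mixm N m p)).card =
      (((Finset.univ : Finset (In N)).powersetCard m).filter fun S => ¬ S ⊆ Dm N p ∧ ¬ S ⊆ Gm N p).card := by
    congr 1
    ext t
    simp only [Finset.mem_filter, Finset.mem_univ, true_and, Mixm, Finset.mem_powersetCard_univ]
  rw [Mm, finrank_Sp, hf]
  exact h

/-- `dim Λ^m = C(2N,m)`. -/
lemma finrank_Hom_univ (m : ℕ) : Module.finrank K ↥(Hom K (In N) Finset.univ m) = (N + N).choose m := by
  classical
  rw [Hom_univ_eq_Sp, finrank_Sp]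
  have h : (Finset.univ.filter (Degm N m)) = (Finset.univ : Finset (In N)).powersetCard m := by
    ext t; simp [Degm]
  rw [h, Finset.card_powersetCard, Finset.card_univ, Fintype.card_fin]

/-- membership in `MXm`: size `m`, meets `Ap` and `Am`. -/
lemma mem_MXm {m p : ℕ} {S : Finset (Fin N)} :
    S ∈ MXm N m p ↔ S.card = m ∧ (∃ a ∈ S, (a : ℕ) < p) ∧ (∃ b ∈ S, p ≤ (b : ℕ)) := by
  rw [MXm, Finset.mem_filter, Finset.mem_powersetCard_univ, Finset.not_subset, Finset.not_subset]
  simp only [compl_Ap, mem_Ap, mem_Am, not_lt, not_le]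
  tauto

/-- **mixed decomposition in degree m:** `(Mm) ∧ f = Σ_{S ∈ MXm} (Sp (Sel S)) ∧ f`. -/
lemma map_f_Mm_eq {m p : ℕ} (q : ℕ → K) :
    (Mm K N m p).map (LinearMap.mulRight K (w K N N q)) =
      ⨆ S ∈ MXm N m p, (Sp K (Sel N S)).map (LinearMap.mulRight K (w K N N q)) := by
  classical
  apply le_antisymm
  · rw [Submodule.map_le_iff_le_comap, Mm, Sp]
    apply Submodule.span_le.mpr
    rintro _ ⟨t, ⟨ht, h2, h3⟩, rfl⟩
    rw [SetLike.mem_coe, Submodule.mem_comap, LinearMap.mulRight_apply]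
    dsimp only
    rcases sel_or_pair (N := N) t with hsel | ⟨i, hi, hpi⟩
    · obtain ⟨i, hit, hi⟩ := Finset.not_subset.mp h3
      obtain ⟨j, hjt, hj⟩ := Finset.not_subset.mp h2
      have hS : t.image pr ∈ MXm N m p := by
        rw [mem_MXm]
        refine ⟨by rw [← ht]; exact hsel.1.symm, ⟨pr i, Finset.mem_image_of_mem pr hit, ?_⟩,
          ⟨pr j, Finset.mem_image_of_mem pr hjt, ?_⟩⟩
        · exact (mem_Dm_iff i).mp (mem_Dm_of_not_mem_Gm hi)
        · exact (mem_Gm_iff j).mp (mem_Gm_of_not_mem_Dm hj)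
      have hmem : B K (In N) t * w K N N q ∈ (Sp K (Sel N (t.image pr))).map (LinearMap.mulRight K (w K N N q)) :=
        Submodule.mem_map_of_mem (B_mem_Sp hsel)
      exact le_biSup (fun S => (Sp K (Sel N S)).map (LinearMap.mulRight K (w K N N q))) hS hmem
    · rw [B_mul_f_eq_zero_of_pair K hi hpi]; exact Submodule.zero_mem _
  · refine iSup₂_le fun S hS => Submodule.map_mono ?_
    rw [mem_MXm] at hS
    obtain ⟨hS1, ⟨a, haS, ha⟩, ⟨c, hcS, hc⟩⟩ := hS
    refine Sp_mono fun t ht => ⟨ht.1.trans hS1, fun h => ?_, fun h => ?_⟩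
    · obtain ⟨i, hi, he⟩ := ht.exists_mem hcS
      have := (mem_Dm_iff i).mp (h hi)
      rw [he] at this; omega
    · obtain ⟨i, hi, he⟩ := ht.exists_mem haS
      have := (mem_Gm_iff i).mp (h hi)
      rw [he] at this; omega

/-- `dim (Mm ∧ f) = |MXm| · rank H_m(q)`. -/
lemma finrank_map_f_Mm {m p : ℕ} (q : ℕ → K) :
    Module.finrank K ↥((Mm K N m p).map (LinearMap.mulRight K (w K N N q))) =
      (MXm N m p).card * (hankel1 K N m q).rank := by
  classical
  have hMX : ∀ S ∈ MXm N m p, S.card = m := fun S hS => (mem_MXm.mp hS).1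
  rw [map_f_Mm_eq K q,
    finrank_biSup_eq_sum _ _ (fun S => Qpred N S) (fun S _ => map_f_Sel_le K S q)
      (fun S _ S' _ hSS' => Qpred_disjoint hSS'),
    Finset.sum_const_nat (m := (hankel1 K N m q).rank) (fun S hS => finrank_map_f_Sel K (hMX S hS) q)]

/-- **THEOREM R IN EVERY DEGREE (signature (p, N−p); PART B §L.8).** For `1 ≤ m`, `m < N − p`, `a b ≠ 0`, ANY `q`, ANY field:
`rank(⌟v ∣ HT^m) = C(2p,m) + C(2(N−p),m) + (C(N,m) − C(p,m) − C(N−p,m))·rank H_m(q)`, additively. -/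
theorem weilRank_deg {m p : ℕ} (hm1 : 1 ≤ m) (hm : m + 1 ≤ N - p) (q : ℕ → K) {a b : K} (ha : a ≠ 0) (hb : b ≠ 0) :
    Module.finrank K (LinearMap.range (wedge K N m (vW K N p q a b))) +
        (p.choose m + (N - p).choose m) * (hankel1 K N m q).rank =
      (p + p).choose m + ((N + N) - (p + p)).choose m + N.choose m * (hankel1 K N m q).rank := by
  have hp : p ≤ N := by omega
  have H1 := finrank_eq_map_add_inf_ker K (Hom K (In N) Finset.univ m) (LinearMap.mulRight K (vW K N p q a b))
  have H2 := finrank_eq_map_add_inf_ker K (Mm K N m p) (LinearMap.mulRight K (w K N N q))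
  rw [ker_eq_deg K hm q ha hb, finrank_Hom_univ, ← range_wedge] at H1
  rw [finrank_map_f_Mm K q] at H2
  have hM := finrank_Mm K (m := m) hm1 hp
  have hMX := card_MXm (N := N) (m := m) hm1 hp
  have hI : N.choose m * (hankel1 K N m q).rank =
      (MXm N m p).card * (hankel1 K N m q).rank + (p.choose m + (N - p).choose m) * (hankel1 K N m q).rank := by
    rw [← hMX]; ring
  omega

/-- **THEOREM R in every degree, Weil type (n,n), 1 ≤ m < n (PART B §L.8 / gs-eng-1 §2″):**
`rank(⌟v ∣ HT^m) = C(2n,m)·(2 + ρ_m) − 2ρ_m·C(n,m)`, here as `finrank + (C(n,m)+C(n,m))ρ_m = C(2n,m) + C(2n,m) + C(2n,m)ρ_m`. -/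
theorem weilRank_nn_deg {n m : ℕ} (hm1 : 1 ≤ m) (hmn : m + 1 ≤ n) (q : ℕ → K) {a b : K} (ha : a ≠ 0) (hb : b ≠ 0) :
    Module.finrank K (LinearMap.range (wedge K (n + n) m (vW K (n + n) n q a b))) +
        (n.choose m + n.choose m) * (hankel1 K (n + n) m q).rank =
      (n + n).choose m + (n + n).choose m + (n + n).choose m * (hankel1 K (n + n) m q).rank := by
  have h := weilRank_deg K (N := n + n) (p := n) (m := m) hm1 (by omega) q ha hb
  rw [Nat.add_sub_cancel_left, Nat.add_sub_cancel_left] at h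
  exact h

end AllDegrees

end Summit.Ventures.HSemireg.Wedge.Weil
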